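import Summits.Ventures.PackingBounds.ThreePointCert.CheckExactD

/-!
# Kernel checker for EXACT three-point ENERGY certificates (Cohn–Woo 2012, Theorem 3.2) — programs

Framing: lottery ticket; floor = certified bounds/negative ranges. Venture `PackingBounds`
(cell `pub-packcert`), energy family E3PT (pub-packcert-energy gen 27; KERNEL-DIPLO route).

The energy analogue of `ThreePointCert.CheckExact` (which treats Bachoc–Vallentin's bound for
spherical codes).  A certificate for the `p`-energy of `N` points on `S^{n-1}` consists of a
polynomial pair potential `p` (in applications a Hermite minorant of the true potential), a
constant `c`, a two-point part `A = Σ_k (A_k/λ_A) C_k^{(n-2)/2}`, a three-point part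
`F = FvalX/λ_F` given by lifted face blocks (`ThreePointCert.FBlkX`), and sums of squares
`Σ_g κ_g Σ_{parts of group g} Σ_{j,l} M_{jl} b_j b_l` (`ThreePointCert.SymPart`), such that
EXACTLY (as polynomials in `u, v, t`)
`(p(u)+p(v)+p(t))/3 - c - (N-2) F(u,v,t) - F(u,u,1) - F(v,v,1) - F(t,t,1) - (A(u)+A(v)+A(t))/3
   = Σ_g (κ_g/Λ) TOT_g ≥ 0`.
Then `Σ_{x ≠ y ∈ C} p(x·y) ≥ N((N-1)c - F(1,1,1) - A(1)) = bNum/bDen` for every `N`-point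
configuration `C ⊂ S^{n-1}` [cite: CohnWoo2012, Theorem 3.2] — proved in
`Energy.ThreePointCertEnergySound` from `Literature…CohnWoo.energy_ge_of_threePoint`.

This file: plain `List`/`ℤ`/`ℕ` programs run by the kernel (`decide`): the record `CertE`, the
claimed expansions `PolysE`, the identity check `checkIdE` (trie-free, all coefficients zero after
scaling every summand to the common scale `Λ`), the value check `checkValE` and the side
conditions `checkSideE`.  Everything about blocks / parts / the three-point expansion is REUSED from
`ThreePointCert.CheckExact(D)` (`PSDBlk`, `Lift`, `SymPart`, `FBlkX`, `FPolyX`, `partChunkOKD`, …).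
-/

noncomputable section

namespace Summit.Ventures.PackingBounds.Energy.ThreePointCertE

open Literature.Geometry.DiscreteGeometry Literature.Geometry.DiscreteGeometry.PolyCert
open Literature.Geometry.DiscreteGeometry.PolyCert.SPoly
open Summit.Ventures.PackingBounds.ThreePointCert

/-- An exact three-point ENERGY certificate in integer units.  Real meaning (see the `Sound` file):
`p(t) = (Σ_i pP[i] t^i)/pDen`, `c = cNum/cDen`, `A(u) = AvalG n A u/lamA`, `F = FvalX n F/lamF`,
sums of squares `Σ_g kR[g] · (parts R[g])`, claimed bound `bNum/bDen`; the multipliers satisfy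
`kp·3·pDen = kc·cDen = kF·W·lamF = kA·3·W·lamA = Lam` (`W = 2^d d!`). -/
structure CertE where
  /-- dimension (`S^{n-1} ⊂ ℝⁿ`) -/
  n : ℕ
  /-- SDP degree -/
  d : ℕ
  /-- number of points -/
  N : ℕ
  /-- common scale `Λ > 0` of the identity -/
  Lam : ℕ
  /-- coefficients of the pair potential `p` (ascending), scale `pDen` -/
  pP : List ℤ
  /-- see `pP` -/
  pDen : ℕ
  /-- multiplier of the `p`-summand: `kp · 3 · pDen = Λ` -/
  kp : ℕ
  /-- the constant `c = cNum / cDen` -/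
  cNum : ℤ
  /-- see `cNum` -/
  cDen : ℕ
  /-- multiplier of the constant: `kc · cDen = Λ` -/
  kc : ℕ
  /-- two-point coefficients `A_0, …` (Gegenbauer `C_k^{(n-2)/2}` basis), scale `lamA` -/
  A : List ℕ
  /-- see `A` -/
  lamA : ℕ
  /-- multiplier of the two-point summand: `kA · 3 · W · lamA = Λ` -/
  kA : ℕ
  /-- three-point blocks (lifted face blocks), scale `lamF` -/
  F : List FBlkX
  /-- see `F` -/
  lamF : ℕ
  /-- multiplier of the three-point summand: `kF · W · lamF = Λ` -/
  kF : ℕ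
  /-- groups of sum-of-squares parts -/
  R : List (List SymPart)
  /-- nonnegative multiplier of each group -/
  kR : List ℕ
  /-- numerator of the claimed bound -/
  bNum : ℤ
  /-- denominator of the claimed bound (positive) -/
  bDen : ℕ

/-- Claimed expansions of an energy certificate (validated separately by kernel chunk checks):
`FP ≡ FPolyX n d F`, `TOT[g] ≡ Σ_{parts of group g} (all rows)`. -/
structure PolysE where
  /-- the three-point expansion -/
  FP : SPoly
  /-- the totals of the sum-of-squares groups -/
  TOT : List SPoly

/-- The potential `p` as a term list in `u` (ascending monomials, scale `pDen`). -/
def pPolyU (c : CertE) : SPoly := (List.range c.pP.length).map fun i => (⟨i, 0, 0⟩, c.pP.getD i 0)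

/-- `q(u) + q(v) + q(t)` for a term list `q` in `u` (sorted normal form). -/
def sum3 (q : SPoly) : SPoly := normalize (q ++ permBAC q ++ permCBA q)

/-- `pDen · (p(u) + p(v) + p(t))`. -/
def P3 (c : CertE) : SPoly := sum3 (pPolyU c)

/-- `W·lamA · (A(u) + A(v) + A(t))`. -/
def A3 (c : CertE) : SPoly := sum3 (APolyG c.n c.d c.A)

/-- `(N-2)·FP + FP(u,u,1) + FP(v,v,1) + FP(t,t,1)` (sorted normal form). -/
def FT (c : CertE) (FP : SPoly) : SPoly :=
  normalize (smul ((c.N : ℤ) - 2) FP ++ (substUU1 FP ++ permBAC (substUU1 FP) ++ permCBA (substUU1 FP)))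

/-- The scaled identity polynomial
`kp·P3 - kc·cNum - kF·FT - kA·A3 - Σ_g kR[g]·TOT[g]` (must vanish identically). -/
def idPolyE (c : CertE) (P : PolysE) : SPoly :=
  mergeAll ([smul (c.kp : ℤ) (P3 c), C (-((c.kc : ℤ) * c.cNum)), smul (-(c.kF : ℤ)) (FT c P.FP),
      smul (-(c.kA : ℤ)) (A3 c)] ++
    List.zipWith (fun (k : ℕ) (T : SPoly) => smul (-(k : ℤ)) T) c.kR P.TOT)

/-- The identity check: group bookkeeping and all coefficients of `idPolyE` vanish. -/
def checkIdE (c : CertE) (P : PolysE) : Bool :=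
  decide (c.kR.length = c.R.length) && decide (P.TOT.length = c.R.length) && allZero (idPolyE c P)

/-- The value check: `bNum·Λ = bDen · N·((N-1)·kc·cNum - kF·ΣFP - 3·kA·ΣAP)`, i.e.
`bNum/bDen = N((N-1)c - F(1,1,1) - A(1))`. -/
def checkValE (c : CertE) (P : PolysE) : Bool :=
  decide ((c.bNum : ℤ) * c.Lam =
    (c.bDen : ℤ) * ((c.N : ℤ) * (((c.N : ℤ) - 1) * ((c.kc : ℤ) * c.cNum) - (c.kF : ℤ) * coeffSum P.FP
      - 3 * (c.kA : ℤ) * coeffSum (APolyG c.n c.d c.A))))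

/-- Side conditions: `n ≥ 4`, `N ≥ 3`, `Λ > 0`, the four multiplier equations, `bDen > 0`,
`|A| ≤ d + 1`, shapes of all three-point blocks and of all parts, one multiplier per group. -/
def checkSideE (c : CertE) : Bool :=
  decide (4 ≤ c.n) && decide (3 ≤ c.N) && decide (0 < c.Lam) &&
    decide (c.kp * (3 * c.pDen) = c.Lam) && decide (c.kc * c.cDen = c.Lam) &&
    decide (c.kF * (Wfac c.d * c.lamF) = c.Lam) && decide (c.kA * (3 * (Wfac c.d * c.lamA)) = c.Lam) &&
    decide (0 < c.bDen) && decide (c.A.length ≤ c.d + 1) &&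
    (c.F.all (fblkShapeOK c.d)) && (c.R.all fun g => g.all partShapeOK) && decide (c.kR.length = c.R.length)

end Summit.Ventures.PackingBounds.Energy.ThreePointCertE

end
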